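import Literature.LinearAlgebra.Matrix.SchurComplementQuotient
import HarnessLib

/-!
# Block (domain) factorization of the determinant of a three-block matrix whose outer blocks
# are not directly coupled (Cè–Giusti–Schaefer): `det Q · det Q_{Λ₁₁} = det Q_{Ω*₀} ·
# det Q_{Ω*₁} · det (1 − w)`

Topic `Analysis/Matrix` (the Schur-complement story of
`Literature/LinearAlgebra/Matrix/SchurComplementQuotient.lean`, which this file imports for
`schurCompl`, the Schur determinant identity and the Banachiewicz block inverse).  PUBLISHED RESULT
with our formalisation of the printed four-step derivation; exact block-matrix algebra over a
commutative ring (a field for the 'as printed' quotient form); no named fact (`def … : Prop`) is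
introduced (D-0026).

HONEST FRAMING: exact (Metropolis-corrected) sampling algorithms for lattice gauge theory; figures
of merit are autocorrelation/cost numbers at stated couplings and volumes; no continuum-physics claim.

## Sources (read on the held texts `paper:arxiv-1609.02419`, pp. 3–4, 14;
## `paper:arxiv-1601.04587`, pp. 3, 5; `paper:arxiv-2203.02247`, pp. 4, 13) and what is taken

M. Cè, L. Giusti, S. Schaefer, *Local factorization of the fermion determinant in lattice QCD*,
Phys. Rev. D 95 (2017) 034503 [CeGiustiSchaefer2017], §2 "Block decomposition of the
determinant" and Appendix A "LU decomposition of a 2 × 2 block matrix".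

§2: "a decomposition of the lattice in three blocks `Λ_i`, `i = 0,1,2`, … the only requirement is
that the Dirac operator does not connect the blocks `Λ₀` with `Λ₂` directly", the block form (first display of §2)
`Q = [[Q_{Λ₀₀}, Q_{Λ₀₁}, 0], [Q_{Λ₁₀}, Q_{Λ₁₁}, Q_{Λ₁₂}], [0, Q_{Λ₂₁}, Q_{Λ₂₂}]]`; the
two-block operators `Q_{Ω*ᵢ} = [[Q_{Λᵢᵢ}, Q_{Λᵢ,ᵢ₊₁}], [Q_{Λᵢ₊₁,ᵢ}, Q_{Λᵢ₊₁,ᵢ₊₁}]]`, `i = 0, 1`;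
Step 1, eq. `step1`: `det Q = det Q_{Λ₁₁} · det [[Q_{Λ₀₀} − Q_{Λ₀₁}Q_{Λ₁₁}⁻¹Q_{Λ₁₀},
−Q_{Λ₀₁}Q_{Λ₁₁}⁻¹Q_{Λ₁₂}], [−Q_{Λ₂₁}Q_{Λ₁₁}⁻¹Q_{Λ₁₀}, Q_{Λ₂₂} − Q_{Λ₂₁}Q_{Λ₁₁}⁻¹Q_{Λ₁₂}]]`
"where the second matrix on the rhs is the Schur complement associated to `Γ`" (`Γ = Λ₀ ∪ Λ₂`,
`Γ* = Λ₁`); Step 2, eq. `step2`: `det Q = 1 / (det Q⁻¹_{Λ₁₁} det[P_{Λ₂} Q⁻¹_{Ω*₁} P_{Λ₂}]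
det[P_{Λ₀} Q⁻¹ P_{Λ₀}])` "where each determinant is the one of the nonzero submatrix indicated;
e.g. `det[P_{Λ₂} Q⁻¹_{Ω*₁} P_{Λ₂}]` stands for the determinant of the inverse of the Schur
complement of `Q⁻¹_{Ω*₁}` in `Λ₂`"; Step 3, eq. `step3`: `1/det[P_{Λ₀} Q⁻¹ P_{Λ₀}] =
(1/det[P_{Λ₀} Q⁻¹_{Ω*₀} P_{Λ₀}]) · det [[1, P_{Λ₀} Q⁻¹_{Ω*₀} Q_{Λ₁₂}], [P_{Λ₂} Q⁻¹_{Ω*₁} Q_{Λ₁₀},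
1]]`; Step 4 (its display): `det [[1, P_{Λ₀}Q⁻¹_{Ω*₀}Q_{Λ₁₂}], [P_{Λ₂}Q⁻¹_{Ω*₁}Q_{Λ₁₀}, 1]] =
det (1 − P_{∂Λ₀} Q⁻¹_{Ω*₀} Q_{Λ₁₂} P_{∂Λ₂} Q⁻¹_{Ω*₁} Q_{Λ₁₀} P_{∂Λ₀})` with the boundary
projectors `P_{∂Λᵢ} Q_{Λᵢⱼ} = Q_{Λᵢⱼ} P_{∂Λⱼ} = Q_{Λᵢⱼ}`, `i ≠ j` (the display after Step 4); the factorized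
formula, **eq. `factfinal`**: `det Q = det (1 − w) / (det Q⁻¹_{Λ₁₁} det[P_{Λ₀} Q⁻¹_{Ω*₀} P_{Λ₀}]
det[P_{Λ₂} Q⁻¹_{Ω*₁} P_{Λ₂}])` with (the display following it) `w = P_{∂Λ₀} Q⁻¹_{Ω*₀} Q_{Λ₁₂} Q⁻¹_{Ω*₁}
Q_{Λ₁₀}`; "det `Q⁻¹₁₁` depends on the gauge field in the block `Λ₁`, `det[P_{Λ₀} Q⁻¹_{Ω*₀}
P_{Λ₀}]` on the gauge fields in `Λ₀ ∪ Λ₁`, and `det[P_{Λ₂} Q⁻¹_{Ω*₁} P_{Λ₂}]` on the gauge field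
in `Λ₁ ∪ Λ₂`. Only the (small) correction `det (1 − w)` is a function of all the links";
§3 footnote: "The identity `det Q⁻¹_{Λ₁₁} · det[P_{Λ₀} Q⁻¹_{Ω*₀} P_{Λ₀}] = det Q⁻¹_{Ω*₀}` can be
used to speed up the simulation".  Appendix A "LU decomposition of a 2 × 2 block matrix" (its four displays; the
determinant one is eq. `detblock`): `Q = [[Q_Γ, Q_∂Γ], [Q_∂Γ*,
Q_Γ*]] = [[I, Q_∂Γ Q_Γ*⁻¹], [0, I]] [[S_Γ, 0], [Q_∂Γ*, Q_Γ*]]`, `S_Γ = Q_Γ − Q_∂Γ Q_Γ*⁻¹ Q_∂Γ*`,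
`det Q = det (Q_Γ − Q_∂Γ Q_Γ*⁻¹ Q_∂Γ*) det Q_Γ*`, `Q⁻¹ = [[S_Γ⁻¹, −S_Γ⁻¹ Q_∂Γ Q_Γ*⁻¹],
[−Q_Γ*⁻¹ Q_∂Γ* S_Γ⁻¹, Q_Γ*⁻¹ + Q_Γ*⁻¹ Q_∂Γ* S_Γ⁻¹ Q_∂Γ Q_Γ*⁻¹]]`, "`S_Γ⁻¹` is the exact inverse
of `Q` if the source and the sink positions are both in `Γ`".

## Lean reading

The three domains are arbitrary finite index types `l₀ l₁ l₂` (sites × spin × colour of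
`Λ₀, Λ₁, Λ₂`); the seven non-zero blocks of the block form are bundled in `Blocks K l₀ l₁ l₂`; `B.full` is
that matrix on `(l₀ ⊕ l₁) ⊕ l₂`, `B.omega₀ = Q_{Ω*₀}`, `B.omega₁ = Q_{Ω*₁}`,
`B.schur₀ = Q_{Λ₀₀} − Q_{Λ₀₁}Q_{Λ₁₁}⁻¹Q_{Λ₁₀}` (so `[P_{Λ₀} Q⁻¹_{Ω*₀} P_{Λ₀}] = schur₀⁻¹`,
`omega₀_inv_toBlocks₁₁`), `B.schur₂ = Q_{Λ₂₂} − Q_{Λ₂₁}Q_{Λ₁₁}⁻¹Q_{Λ₁₂}`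
(`[P_{Λ₂} Q⁻¹_{Ω*₁} P_{Λ₂}] = schur₂⁻¹`, `omega₁_inv_toBlocks₂₂`), and `B.w` is the printed `w` read as
the `l₀ × l₀` matrix `(Q_{Ω*₀}⁻¹)_{Λ₀Λ₁} Q_{Λ₁₂} (Q_{Ω*₁}⁻¹)_{Λ₂Λ₁} Q_{Λ₁₀}` (the projector
`P_{∂Λ₀}` only records that `Q_{Λ₁₀}` sees the inner boundary; `det_one_sub_boundary_eq` shows the
determinant is unchanged by inserting such projectors, which is all Step 4 and eq. `factfinal` use).  Inverses
are Mathlib's nonsingular inverses; the hypotheses are `IsUnit (det Q_{Λ₁₁})`,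
`IsUnit (det Q_{Ω*₀})`, `IsUnit (det Q_{Ω*₁})` (and `IsUnit (det Q)` where `Q⁻¹` is mentioned) —
the paper divides by these determinants.

## What is formalised

* Appendix A: `inv_fromBlocks_of_isUnit_det₂₂` (the printed block inverse around the trailing
  block), `det_omega₀` / `det_omega₁` (eq. `detblock` for `Q_{Ω*₀}`, `Q_{Ω*₁}`: `det Q_{Ω*₀} = det Q_{Λ₁₁} ·
  det schur₀`, `det Q_{Ω*₁} = det Q_{Λ₁₁} · det schur₂`), `omega₀_inv_toBlocks₁₁/₁₂`,
  `omega₁_inv_toBlocks₂₂/₂₁/₁₁` (the blocks of `Q_{Ω*ᵢ}⁻¹`);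
* `w_eq` — `w = schur₀⁻¹ Q_{Λ₀₁} Q_{Λ₁₁}⁻¹ Q_{Λ₁₂} schur₂⁻¹ Q_{Λ₂₁} Q_{Λ₁₁}⁻¹ Q_{Λ₁₀}`;
* **`det_full_step1`** — eq. `step1`;
* `det_fromBlocks_one_one_eq` — the Step-4 display without projectors: `det [[1, X], [Y, 1]] = det (1 − w)`
  for `X = (Q_{Ω*₀}⁻¹)_{Λ₀Λ₁}Q_{Λ₁₂}`, `Y = (Q_{Ω*₁}⁻¹)_{Λ₂Λ₁}Q_{Λ₁₀}`; `det_one_sub_boundary_eq` —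
  Step 4 with the boundary-projector display: inserting projectors `P₀`, `P₂` with `Q_{Λ₁₀}P₀ = Q_{Λ₁₀}`, `Q_{Λ₁₂}P₂ = Q_{Λ₁₂}`
  does not change `det (1 − w)`;
* **`det_full_eq`** — `det Q = det Q_{Λ₁₁} · det schur₀ · det schur₂ · det (1 − w)`, and the two
  printed shapes **`det_full_mul_det`** (`det Q · det Q_{Λ₁₁} = det Q_{Ω*₀} · det Q_{Ω*₁} ·
  det (1 − w)`) and **`det_full_mul_inv_dets`** / **`det_full_eq_div`** — eq. `factfinal`:
  `det Q · (det Q_{Λ₁₁}⁻¹ · det[(Q_{Ω*₀}⁻¹)_{Λ₀Λ₀}] · det[(Q_{Ω*₁}⁻¹)_{Λ₂Λ₂}]) = det (1 − w)`, resp.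
  the quotient over a field;
* `det_inv_Q₁₁_mul_det_omega₀_inv_toBlocks₁₁` — the §3 footnote identity;
* **`inv_full_toBlocks₀₀`**, `det_full_mul_step2`, `det_step3` — eqs. `step2`, `step3` with
  `[P_{Λ₀} Q⁻¹ P_{Λ₀}] = (schur₀ (1 − w))⁻¹` when `Q` is invertible;
* `inv_toBlocks₁₁_eq_propagator`, `inv_toBlocks₂₁_eq_propagator` — the exact two-block propagator
  identities of the companion paper Cè–Giusti–Schaefer, Phys. Rev. D 93 (2016) 094507
  [CeGiustiSchaefer2016] (§2 eq. `bella`: `(D⁻¹)_{ΓΓ} = D_Γ⁻¹ + D_Γ⁻¹D_∂Γ(D⁻¹)_{Γ*Γ*}D_∂Γ*D_Γ⁻¹`;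
  §4 Step 2 eq. `stp2`: `(D⁻¹)_{Ω*Ω} = −D_Ω*⁻¹ D_∂Ω* (D⁻¹)_{ΩΩ}`), and in the three-block setting
  **`inv_full_apply₂₀`** — `(Q⁻¹)_{Λ₂Λ₀} = −(Q_{Ω*₁}⁻¹)_{Λ₂Λ₁} Q_{Λ₁₀} (schur₀(1 − w))⁻¹`;
* `omega₀_inv_mul_eq_propagator`, `omega₁_inv_mul_eq_propagator` — §2.1's rewriting of
  `Q_{Ω*₀}⁻¹ Q_{Λ₁₂}` and `Q_{Ω*₁}⁻¹ Q_{Λ₁₀}` through the full propagator `Q⁻¹` (both lines of the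
  §2.1 display, on the `Λ₀ ∪ Λ₁` resp. `Λ₁ ∪ Λ₂` rows);
* **`det_full_separator`** — the complementary elimination order (interiors `Λ₀`, `Λ₂` first,
  separator `Λ₁` last): `det Q = det Q_{Λ₀₀} det Q_{Λ₂₂} det(Q_{Λ₁₁} − Q_{Λ₁₀}Q_{Λ₀₀}⁻¹Q_{Λ₀₁} −
  Q_{Λ₁₂}Q_{Λ₂₂}⁻¹Q_{Λ₂₁})` — Giusti–Saccardi, Phys. Lett. B 829 (2022) 137103 [GiustiSaccardi2022]
  §3 eq. `detD` (`det D = det D_{Λ̄₀} det D_{Λ₁} det D̃_{∂Λ₀}`), and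
  `det_fromBlocks_eq_det_mul_det_mul_det_reduced` — their App. A eq. `reduced` (the reduced
  determinant `det[[A,B],[C,D]] = det A det D det[[𝟙, 𝒜⁻¹ℬ],[𝒟⁻¹𝒞, 𝟙]]` on the supports of `B`, `C`);
* `star_det_one_sub_w` — "`det (1 − w)` is real since all other determinants entering
  Eq. (factfinal) are real" (Hermitian `Q` over `ℂ`).

Locality is syntactic: `det Q_{Λ₁₁}` mentions only `Q₁₁`, `det Q_{Ω*₀}` only the blocks with
indices in `{0,1}`, `det Q_{Ω*₁}` only those in `{1,2}`; `w` is the only term using all seven.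
NOT formalised: the many-block (even–odd thick-time-slice) generalization of Appendix B, the
spectrum of `w` (§2.2), the multiboson representation of `det (1 − w)` (§3).
-/

noncomputable section

open Matrix

namespace Literature.Analysis.Matrix

namespace DeterminantDomainFactorization

open Literature.LinearAlgebra.Matrix

variable {K : Type*} [CommRing K]
variable {l₀ l₁ l₂ : Type*} [Fintype l₀] [Fintype l₁] [Fintype l₂]
  [DecidableEq l₀] [DecidableEq l₁] [DecidableEq l₂]

/-! ### Appendix A for the trailing pivot -/

omit [Fintype l₂] [DecidableEq l₂] in
/-- **Block inverse around an invertible trailing block** (Banachiewicz), the last display of App. A: for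
`Q = [[Q_Γ, Q_∂Γ], [Q_∂Γ*, Q_Γ*]]` with `Q_Γ*` and `S_Γ = Q_Γ − Q_∂Γ Q_Γ*⁻¹ Q_∂Γ*` nonsingular,
`Q⁻¹ = [[S_Γ⁻¹, −S_Γ⁻¹Q_∂Γ Q_Γ*⁻¹], [−Q_Γ*⁻¹Q_∂Γ* S_Γ⁻¹, Q_Γ*⁻¹ + Q_Γ*⁻¹Q_∂Γ* S_Γ⁻¹Q_∂Γ Q_Γ*⁻¹]]`
(Mathlib's `Matrix.invOf_fromBlocks₂₂_eq` with nonsingular inverses).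
[cite: CeGiustiSchaefer2017, App. A, block-inverse display] -/
theorem inv_fromBlocks_of_isUnit_det₂₂ (A : Matrix l₀ l₀ K) (B : Matrix l₀ l₁ K)
    (C : Matrix l₁ l₀ K) (D : Matrix l₁ l₁ K) (hD : IsUnit D.det)
    (hS : IsUnit (A - B * D⁻¹ * C).det) :
    (fromBlocks A B C D)⁻¹ =
      fromBlocks (A - B * D⁻¹ * C)⁻¹ (-((A - B * D⁻¹ * C)⁻¹ * B * D⁻¹))
        (-(D⁻¹ * C * (A - B * D⁻¹ * C)⁻¹))
        (D⁻¹ + D⁻¹ * C * (A - B * D⁻¹ * C)⁻¹ * B * D⁻¹) := by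
  letI := Matrix.invertibleOfIsUnitDet D hD
  have hS' : IsUnit (A - B * ⅟D * C).det := by rwa [invOf_eq_nonsing_inv]
  letI := Matrix.invertibleOfIsUnitDet _ hS'
  letI := fromBlocks₂₂Invertible A B C D
  rw [← invOf_eq_nonsing_inv (fromBlocks A B C D), invOf_fromBlocks₂₂_eq]
  simp only [invOf_eq_nonsing_inv]

omit [Fintype l₂] [DecidableEq l₂] in
/-- Eq. `detblock`: `det [[Q_Γ, Q_∂Γ], [Q_∂Γ*, Q_Γ*]] = det (Q_Γ − Q_∂Γ Q_Γ*⁻¹ Q_∂Γ*) · det Q_Γ*` for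
nonsingular `Q_Γ*` (Mathlib's `Matrix.det_fromBlocks₂₂`). [cite: CeGiustiSchaefer2017, App. A eq. `detblock`] -/
theorem det_fromBlocks_eq_det_schur_mul_det₂₂ (A : Matrix l₀ l₀ K) (B : Matrix l₀ l₁ K)
    (C : Matrix l₁ l₀ K) (D : Matrix l₁ l₁ K) (hD : IsUnit D.det) :
    (fromBlocks A B C D).det = (A - B * D⁻¹ * C).det * D.det := by
  letI := Matrix.invertibleOfIsUnitDet D hD
  rw [det_fromBlocks₂₂, invOf_eq_nonsing_inv, mul_comm]

/-! ### The exact propagator identities of Cè–Giusti–Schaefer 2016 (two blocks) -/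

omit [Fintype l₂] [DecidableEq l₂] in
/-- **The block propagator identity** of the 2016 paper, §2 eq. `bella`: for
`D = [[D_Γ, D_∂Γ], [D_∂Γ*, D_Γ*]]` (eq. `Scmpt`) and `x, y ∈ Γ`,
"`S(y,x) = S^{(i)}(y,x) + Σ_{w₁,w₂ ∈ ∂Γ*} S^{(i)}(y,w₁) [D_∂Γ D⁻¹ D_∂Γ*](w₁,w₂) S^{(i)}(w₂,x)`,
`S^{(i)} = D_Γ⁻¹`", i.e. `(D⁻¹)_{ΓΓ} = D_Γ⁻¹ + D_Γ⁻¹ D_∂Γ (D⁻¹)_{Γ*Γ*} D_∂Γ* D_Γ⁻¹` — the leading block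
of the Banachiewicz inverse, with `(D⁻¹)_{Γ*Γ*}` the inverse Schur complement (for nonsingular `D_Γ`
and Schur complement). [cite: CeGiustiSchaefer2016, §2 eq. `bella`] -/
theorem inv_toBlocks₁₁_eq_propagator (A : Matrix l₀ l₀ K) (B' : Matrix l₀ l₁ K)
    (C : Matrix l₁ l₀ K) (D : Matrix l₁ l₁ K) (hA : IsUnit A.det)
    (hS : IsUnit (schurCompl A B' C D).det) :
    (fromBlocks A B' C D)⁻¹.toBlocks₁₁ =
      A⁻¹ + A⁻¹ * B' * (fromBlocks A B' C D)⁻¹.toBlocks₂₂ * C * A⁻¹ := by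
  rw [inv_fromBlocks_of_isUnit_det _ _ _ _ hA hS, toBlocks_fromBlocks₁₁, toBlocks_fromBlocks₂₂]

omit [Fintype l₂] [DecidableEq l₂] in
/-- **Step 2 of the 2016 paper's §4**, eq. `stp2` ("By taking the bottom-left off-diagonal element in
Eq. (Scmpt2), one arrives at `D⁻¹_{Γ₀}(y,x) = −Σ D⁻¹_{Ω*}(y,w₁) D_{∂Ω*}(w₁,w₂) D⁻¹_{Γ₀}(w₂,x)`"):
for `D = [[D_Ω, D_∂Ω], [D_∂Ω*, D_Ω*]]` with `D_Ω*` and the Schur complement nonsingular,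
`(D⁻¹)_{Ω*Ω} = −D_Ω*⁻¹ D_∂Ω* (D⁻¹)_{ΩΩ}`. [cite: CeGiustiSchaefer2016, §4 Step 2 eq. `stp2`] -/
theorem inv_toBlocks₂₁_eq_propagator (A : Matrix l₀ l₀ K) (B' : Matrix l₀ l₁ K)
    (C : Matrix l₁ l₀ K) (D : Matrix l₁ l₁ K) (hD : IsUnit D.det)
    (hS : IsUnit (A - B' * D⁻¹ * C).det) :
    (fromBlocks A B' C D)⁻¹.toBlocks₂₁ = -(D⁻¹ * C * (fromBlocks A B' C D)⁻¹.toBlocks₁₁) := by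
  rw [inv_fromBlocks_of_isUnit_det₂₂ _ _ _ _ hD hS, toBlocks_fromBlocks₂₁, toBlocks_fromBlocks₁₁]

/-! ### The three-block matrix and the two-block operators `Q_{Ω*ᵢ}` (§2) -/

/-- The seven non-zero blocks of the three-block operator of §2 (`Q_{Λ₀₂} = Q_{Λ₂₀} = 0`: "the
Dirac operator does not connect the blocks `Λ₀` with `Λ₂` directly").
[cite: CeGiustiSchaefer2017, §2 first display (block form of Q)] -/
structure Blocks (K : Type*) (l₀ l₁ l₂ : Type*) where
  /-- `Q_{Λ₀₀}` -/
  Q₀₀ : Matrix l₀ l₀ K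
  /-- `Q_{Λ₀₁}` -/
  Q₀₁ : Matrix l₀ l₁ K
  /-- `Q_{Λ₁₀}` -/
  Q₁₀ : Matrix l₁ l₀ K
  /-- `Q_{Λ₁₁}` -/
  Q₁₁ : Matrix l₁ l₁ K
  /-- `Q_{Λ₁₂}` -/
  Q₁₂ : Matrix l₁ l₂ K
  /-- `Q_{Λ₂₁}` -/
  Q₂₁ : Matrix l₂ l₁ K
  /-- `Q_{Λ₂₂}` -/
  Q₂₂ : Matrix l₂ l₂ K

namespace Blocks

variable (B : Blocks K l₀ l₁ l₂)

/-- `Q_{Ω*₀} = [[Q_{Λ₀₀}, Q_{Λ₀₁}], [Q_{Λ₁₀}, Q_{Λ₁₁}]]`. [cite: CeGiustiSchaefer2017, §2 display defining Q_{Ω*_i}] -/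
def omega₀ : Matrix (l₀ ⊕ l₁) (l₀ ⊕ l₁) K := fromBlocks B.Q₀₀ B.Q₀₁ B.Q₁₀ B.Q₁₁

/-- `Q_{Ω*₁} = [[Q_{Λ₁₁}, Q_{Λ₁₂}], [Q_{Λ₂₁}, Q_{Λ₂₂}]]`. [cite: CeGiustiSchaefer2017, §2 display defining Q_{Ω*_i}] -/
def omega₁ : Matrix (l₁ ⊕ l₂) (l₁ ⊕ l₂) K := fromBlocks B.Q₁₁ B.Q₁₂ B.Q₂₁ B.Q₂₂

/-- The full operator of §2 on `(Λ₀ ⊕ Λ₁) ⊕ Λ₂`, written as the two-block matrix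
`[[Q_{Ω*₀}, (0; Q_{Λ₁₂})], [(0, Q_{Λ₂₁}), Q_{Λ₂₂}]]`. [cite: CeGiustiSchaefer2017, §2 first display (block form of Q)] -/
def full : Matrix ((l₀ ⊕ l₁) ⊕ l₂) ((l₀ ⊕ l₁) ⊕ l₂) K :=
  fromBlocks B.omega₀ (fromRows 0 B.Q₁₂) (fromCols 0 B.Q₂₁) B.Q₂₂

/-- `Q_{Λ₀₀} − Q_{Λ₀₁} Q_{Λ₁₁}⁻¹ Q_{Λ₁₀}`, the Schur complement of `Q_{Λ₁₁}` in `Q_{Ω*₀}` — the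
`(0,0)` entry of the Step-1 matrix (eq. `step1`), and the inverse of `[P_{Λ₀} Q_{Ω*₀}⁻¹ P_{Λ₀}]`.
[cite: CeGiustiSchaefer2017, §2 Step 1 eq. `step1`] -/
def schur₀ : Matrix l₀ l₀ K := B.Q₀₀ - B.Q₀₁ * B.Q₁₁⁻¹ * B.Q₁₀

/-- `Q_{Λ₂₂} − Q_{Λ₂₁} Q_{Λ₁₁}⁻¹ Q_{Λ₁₂}`, the Schur complement of `Q_{Λ₁₁}` in `Q_{Ω*₁}` — the
`(2,2)` entry of the Step-1 matrix (eq. `step1`), and the inverse of `[P_{Λ₂} Q_{Ω*₁}⁻¹ P_{Λ₂}]`.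
[cite: CeGiustiSchaefer2017, §2 Step 1 eq. `step1`] -/
def schur₂ : Matrix l₂ l₂ K := B.Q₂₂ - B.Q₂₁ * B.Q₁₁⁻¹ * B.Q₁₂

/-- **`w = P_{∂Λ₀} Q⁻¹_{Ω*₀} Q_{Λ₁₂} Q⁻¹_{Ω*₁} Q_{Λ₁₀}`** as an operator on the `Λ₀` field:
`(Q_{Ω*₀}⁻¹)_{Λ₀Λ₁} · Q_{Λ₁₂} · (Q_{Ω*₁}⁻¹)_{Λ₂Λ₁} · Q_{Λ₁₀}`.
[cite: CeGiustiSchaefer2017, §2 definition of w (display after eq. `factfinal`)] -/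
def w : Matrix l₀ l₀ K := B.omega₀⁻¹.toBlocks₁₂ * B.Q₁₂ * B.omega₁⁻¹.toBlocks₂₁ * B.Q₁₀

omit [Fintype l₀] [Fintype l₂] [DecidableEq l₀] [DecidableEq l₂] in
/-- `schur₀` is the tree's `schurCompl` of the pivot `Q_{Λ₁₁}` in `Q_{Ω*₀}` (App. A's `S_Γ` with
`Γ = Λ₀`, `Γ* = Λ₁`). [cite: CeGiustiSchaefer2017, App. A definition of S_Γ] -/
theorem schur₀_eq_schurCompl : B.schur₀ = schurCompl B.Q₁₁ B.Q₁₀ B.Q₀₁ B.Q₀₀ := rfl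

omit [Fintype l₀] [Fintype l₂] [DecidableEq l₀] [DecidableEq l₂] in
/-- `schur₂` is the tree's `schurCompl` of the pivot `Q_{Λ₁₁}` in `Q_{Ω*₁}` (App. A's `S_Γ` with
`Γ = Λ₂`, `Γ* = Λ₁`). [cite: CeGiustiSchaefer2017, App. A definition of S_Γ] -/
theorem schur₂_eq_schurCompl : B.schur₂ = schurCompl B.Q₁₁ B.Q₁₂ B.Q₂₁ B.Q₂₂ := rfl

/-! ### Determinants and inverse blocks of the two-block operators (Appendix A) -/

omit [Fintype l₂] [DecidableEq l₂] in
/-- Eq. `detblock` for `Q_{Ω*₀}` with `Γ = Λ₀`, `Γ* = Λ₁`: `det Q_{Ω*₀} = det Q_{Λ₁₁} · det schur₀`.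
[cite: CeGiustiSchaefer2017, App. A eq. `detblock`] -/
theorem det_omega₀ (h₁ : IsUnit B.Q₁₁.det) : B.omega₀.det = B.Q₁₁.det * B.schur₀.det := by
  rw [omega₀, det_fromBlocks_eq_det_schur_mul_det₂₂ _ _ _ _ h₁, mul_comm]; rfl

omit [Fintype l₀] [DecidableEq l₀] in
/-- Eq. `detblock` for `Q_{Ω*₁}` with the leading pivot `Q_{Λ₁₁}`: `det Q_{Ω*₁} = det Q_{Λ₁₁} · det schur₂`.
[cite: CeGiustiSchaefer2017, App. A eq. `detblock`] -/
theorem det_omega₁ (h₁ : IsUnit B.Q₁₁.det) : B.omega₁.det = B.Q₁₁.det * B.schur₂.det := by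
  rw [omega₁, det_fromBlocks_eq_det_mul_det_schurCompl _ _ _ _ h₁]; rfl

omit [Fintype l₂] [DecidableEq l₂] in
/-- By eq. `detblock`, `schur₀` is nonsingular when `Q_{Λ₁₁}` and `Q_{Ω*₀}` are (the paper inverts
it as `[P_{Λ₀} Q⁻¹_{Ω*₀} P_{Λ₀}]`). [cite: CeGiustiSchaefer2017, App. A eq. `detblock`] -/
theorem isUnit_det_schur₀ (h₁ : IsUnit B.Q₁₁.det) (h₀ : IsUnit B.omega₀.det) :
    IsUnit B.schur₀.det := by
  rw [B.det_omega₀ h₁] at h₀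
  exact (IsUnit.mul_iff.mp h₀).2

omit [Fintype l₀] [DecidableEq l₀] in
/-- By eq. `detblock`, `schur₂` is nonsingular when `Q_{Λ₁₁}` and `Q_{Ω*₁}` are (the paper inverts
it as `[P_{Λ₂} Q⁻¹_{Ω*₁} P_{Λ₂}]`). [cite: CeGiustiSchaefer2017, App. A eq. `detblock`] -/
theorem isUnit_det_schur₂ (h₁ : IsUnit B.Q₁₁.det) (h₂ : IsUnit B.omega₁.det) :
    IsUnit B.schur₂.det := by
  rw [B.det_omega₁ h₁] at h₂
  exact (IsUnit.mul_iff.mp h₂).2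

omit [Fintype l₂] [DecidableEq l₂] in
/-- The App. A block inverse for `Q_{Ω*₀}`. [cite: CeGiustiSchaefer2017, App. A, block-inverse display] -/
theorem omega₀_inv (h₁ : IsUnit B.Q₁₁.det) (h₀ : IsUnit B.omega₀.det) :
    B.omega₀⁻¹ =
      fromBlocks B.schur₀⁻¹ (-(B.schur₀⁻¹ * B.Q₀₁ * B.Q₁₁⁻¹))
        (-(B.Q₁₁⁻¹ * B.Q₁₀ * B.schur₀⁻¹))
        (B.Q₁₁⁻¹ + B.Q₁₁⁻¹ * B.Q₁₀ * B.schur₀⁻¹ * B.Q₀₁ * B.Q₁₁⁻¹) :=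
  inv_fromBlocks_of_isUnit_det₂₂ _ _ _ _ h₁ (B.isUnit_det_schur₀ h₁ h₀)

omit [Fintype l₂] [DecidableEq l₂] in
/-- "`S_Γ⁻¹` is the exact inverse of `Q` if the source and the sink positions are both in `Γ`":
`[P_{Λ₀} Q_{Ω*₀}⁻¹ P_{Λ₀}] = schur₀⁻¹`. [cite: CeGiustiSchaefer2017, App. A, block-inverse display] -/
theorem omega₀_inv_toBlocks₁₁ (h₁ : IsUnit B.Q₁₁.det) (h₀ : IsUnit B.omega₀.det) :
    B.omega₀⁻¹.toBlocks₁₁ = B.schur₀⁻¹ := by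
  rw [B.omega₀_inv h₁ h₀, toBlocks_fromBlocks₁₁]

omit [Fintype l₂] [DecidableEq l₂] in
/-- `(Q_{Ω*₀}⁻¹)_{Λ₀Λ₁} = −schur₀⁻¹ Q_{Λ₀₁} Q_{Λ₁₁}⁻¹`. [cite: CeGiustiSchaefer2017, App. A, block-inverse display] -/
theorem omega₀_inv_toBlocks₁₂ (h₁ : IsUnit B.Q₁₁.det) (h₀ : IsUnit B.omega₀.det) :
    B.omega₀⁻¹.toBlocks₁₂ = -(B.schur₀⁻¹ * B.Q₀₁ * B.Q₁₁⁻¹) := by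
  rw [B.omega₀_inv h₁ h₀, toBlocks_fromBlocks₁₂]

omit [Fintype l₀] [DecidableEq l₀] in
/-- The App. A block inverse for `Q_{Ω*₁}` around its leading block `Q_{Λ₁₁}` (the tree's
`inv_fromBlocks_of_isUnit_det`). [cite: CeGiustiSchaefer2017, App. A, block-inverse display] -/
theorem omega₁_inv (h₁ : IsUnit B.Q₁₁.det) (h₂ : IsUnit B.omega₁.det) :
    B.omega₁⁻¹ =
      fromBlocks (B.Q₁₁⁻¹ + B.Q₁₁⁻¹ * B.Q₁₂ * B.schur₂⁻¹ * B.Q₂₁ * B.Q₁₁⁻¹)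
        (-(B.Q₁₁⁻¹ * B.Q₁₂ * B.schur₂⁻¹)) (-(B.schur₂⁻¹ * B.Q₂₁ * B.Q₁₁⁻¹)) B.schur₂⁻¹ := by
  rw [omega₁, inv_fromBlocks_of_isUnit_det _ _ _ _ h₁
    (by rw [← schur₂_eq_schurCompl]; exact B.isUnit_det_schur₂ h₁ h₂)]
  rfl

omit [Fintype l₀] [DecidableEq l₀] in
/-- `[P_{Λ₂} Q_{Ω*₁}⁻¹ P_{Λ₂}] = schur₂⁻¹` ("the inverse of the Schur complement of `Q⁻¹_{Ω*₁}` in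
`Λ₂`"). [cite: CeGiustiSchaefer2017, §2 Step 2 and App. A block-inverse display] -/
theorem omega₁_inv_toBlocks₂₂ (h₁ : IsUnit B.Q₁₁.det) (h₂ : IsUnit B.omega₁.det) :
    B.omega₁⁻¹.toBlocks₂₂ = B.schur₂⁻¹ := by
  rw [B.omega₁_inv h₁ h₂, toBlocks_fromBlocks₂₂]

omit [Fintype l₀] [DecidableEq l₀] in
/-- `(Q_{Ω*₁}⁻¹)_{Λ₂Λ₁} = −schur₂⁻¹ Q_{Λ₂₁} Q_{Λ₁₁}⁻¹`. [cite: CeGiustiSchaefer2017, App. A, block-inverse display] -/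
theorem omega₁_inv_toBlocks₂₁ (h₁ : IsUnit B.Q₁₁.det) (h₂ : IsUnit B.omega₁.det) :
    B.omega₁⁻¹.toBlocks₂₁ = -(B.schur₂⁻¹ * B.Q₂₁ * B.Q₁₁⁻¹) := by
  rw [B.omega₁_inv h₁ h₂, toBlocks_fromBlocks₂₁]

omit [Fintype l₀] [DecidableEq l₀] in
/-- `(Q_{Ω*₁}⁻¹)_{Λ₁Λ₁} = Q_{Λ₁₁}⁻¹ + Q_{Λ₁₁}⁻¹ Q_{Λ₁₂} schur₂⁻¹ Q_{Λ₂₁} Q_{Λ₁₁}⁻¹`.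
[cite: CeGiustiSchaefer2017, App. A, block-inverse display] -/
theorem omega₁_inv_toBlocks₁₁ (h₁ : IsUnit B.Q₁₁.det) (h₂ : IsUnit B.omega₁.det) :
    B.omega₁⁻¹.toBlocks₁₁ = B.Q₁₁⁻¹ + B.Q₁₁⁻¹ * B.Q₁₂ * B.schur₂⁻¹ * B.Q₂₁ * B.Q₁₁⁻¹ := by
  rw [B.omega₁_inv h₁ h₂, toBlocks_fromBlocks₁₁]

omit [Fintype l₂] [DecidableEq l₂] in
/-- The §3 footnote: `det Q⁻¹_{Λ₁₁} · det[P_{Λ₀} Q⁻¹_{Ω*₀} P_{Λ₀}] = det Q⁻¹_{Ω*₀}`.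
[cite: CeGiustiSchaefer2017, §3 footnote (identity used "when region 1 is active")] -/
theorem det_inv_Q₁₁_mul_det_omega₀_inv_toBlocks₁₁ (h₁ : IsUnit B.Q₁₁.det)
    (h₀ : IsUnit B.omega₀.det) :
    B.Q₁₁⁻¹.det * (B.omega₀⁻¹.toBlocks₁₁).det = B.omega₀⁻¹.det := by
  rw [B.omega₀_inv_toBlocks₁₁ h₁ h₀, det_nonsing_inv, det_nonsing_inv, det_nonsing_inv,
    B.det_omega₀ h₁, Ring.mul_inverse_rev, mul_comm]

/-! ### `w` in Schur-complement form -/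

/-- `w = schur₀⁻¹ Q_{Λ₀₁} Q_{Λ₁₁}⁻¹ Q_{Λ₁₂} schur₂⁻¹ Q_{Λ₂₁} Q_{Λ₁₁}⁻¹ Q_{Λ₁₀}` (insert the App. A block
inverse twice in the definition of `w`; the two signs cancel).
[cite: CeGiustiSchaefer2017, §2 definition of w with App. A block-inverse display] -/
theorem w_eq (h₁ : IsUnit B.Q₁₁.det) (h₀ : IsUnit B.omega₀.det) (h₂ : IsUnit B.omega₁.det) :
    B.w = B.schur₀⁻¹ * B.Q₀₁ * B.Q₁₁⁻¹ * B.Q₁₂ * B.schur₂⁻¹ * B.Q₂₁ * B.Q₁₁⁻¹ * B.Q₁₀ := by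
  rw [w, B.omega₀_inv_toBlocks₁₂ h₁ h₀, B.omega₁_inv_toBlocks₂₁ h₁ h₂]
  simp only [Matrix.neg_mul, Matrix.mul_neg, neg_neg, Matrix.mul_assoc]

/-- The algebra behind Steps 2–4: `schur₀ · (1 − w) = schur₀ − Q_{Λ₀₁}Q_{Λ₁₁}⁻¹Q_{Λ₁₂} schur₂⁻¹
Q_{Λ₂₁}Q_{Λ₁₁}⁻¹Q_{Λ₁₀}` — the Schur complement of the `(2,2)` entry in the Step-1 matrix.
[cite: CeGiustiSchaefer2017, §2 Steps 1–4] -/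
theorem schur₀_mul_one_sub_w (h₁ : IsUnit B.Q₁₁.det) (h₀ : IsUnit B.omega₀.det)
    (h₂ : IsUnit B.omega₁.det) :
    B.schur₀ * (1 - B.w) =
      B.schur₀ - B.Q₀₁ * B.Q₁₁⁻¹ * B.Q₁₂ * B.schur₂⁻¹ * B.Q₂₁ * B.Q₁₁⁻¹ * B.Q₁₀ := by
  rw [B.w_eq h₁ h₀ h₂, Matrix.mul_sub, Matrix.mul_one]
  simp only [← Matrix.mul_assoc]
  rw [mul_nonsing_inv _ (B.isUnit_det_schur₀ h₁ h₀), Matrix.one_mul]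

/-! ### Step 1 (eq. `step1`) -/

/-- The re-indexing `(Λ₀ ⊕ Λ₁) ⊕ Λ₂ ≃ Λ₁ ⊕ (Λ₀ ⊕ Λ₂)` putting `Γ* = Λ₁` first. [folklore] -/
private def reindex₁ (l₀ l₁ l₂ : Type*) : (l₀ ⊕ l₁) ⊕ l₂ ≃ l₁ ⊕ (l₀ ⊕ l₂) :=
  ((Equiv.sumComm l₀ l₁).sumCongr (Equiv.refl l₂)).trans (Equiv.sumAssoc l₁ l₀ l₂)

omit [Fintype l₀] [Fintype l₁] [Fintype l₂] [DecidableEq l₀] [DecidableEq l₁] [DecidableEq l₂] in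
/-- `Q` with `Λ₁` listed first is the two-block matrix `[[Q_{Λ₁₁}, (Q_{Λ₁₀}, Q_{Λ₁₂})],
[(Q_{Λ₀₁}; Q_{Λ₂₁}), [[Q_{Λ₀₀}, 0], [0, Q_{Λ₂₂}]]]` (`Γ = Λ₀ ∪ Λ₂`, `Γ* = Λ₁`).
[cite: CeGiustiSchaefer2017, §2 Step 1] -/
theorem full_submatrix_reindex₁ :
    B.full.submatrix (reindex₁ l₀ l₁ l₂).symm (reindex₁ l₀ l₁ l₂).symm =
      fromBlocks B.Q₁₁ (fromCols B.Q₁₀ B.Q₁₂) (fromRows B.Q₀₁ B.Q₂₁)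
        (fromBlocks B.Q₀₀ 0 0 B.Q₂₂) := by
  ext (i | (i | i)) (j | (j | j)) <;> rfl

/-- **Step 1, eq. `step1`**: `det Q = det Q_{Λ₁₁} · det [[Q_{Λ₀₀} − Q_{Λ₀₁}Q_{Λ₁₁}⁻¹Q_{Λ₁₀},
−Q_{Λ₀₁}Q_{Λ₁₁}⁻¹Q_{Λ₁₂}], [−Q_{Λ₂₁}Q_{Λ₁₁}⁻¹Q_{Λ₁₀}, Q_{Λ₂₂} − Q_{Λ₂₁}Q_{Λ₁₁}⁻¹Q_{Λ₁₂}]]`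
("the second matrix on the rhs is the Schur complement associated to `Γ`").
[cite: CeGiustiSchaefer2017, §2 Step 1 eq. `step1`] -/
theorem det_full_step1 (h₁ : IsUnit B.Q₁₁.det) :
    B.full.det =
      B.Q₁₁.det * (fromBlocks B.schur₀ (-(B.Q₀₁ * B.Q₁₁⁻¹ * B.Q₁₂))
        (-(B.Q₂₁ * B.Q₁₁⁻¹ * B.Q₁₀)) B.schur₂).det := by
  rw [← det_submatrix_equiv_self (reindex₁ l₀ l₁ l₂).symm B.full, full_submatrix_reindex₁,
    det_fromBlocks_eq_det_mul_det_schurCompl _ _ _ _ h₁, schurCompl_fromCols_fromRows_fromBlocks]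
  congr 3
  · rw [schurCompl_def, zero_sub]
  · rw [schurCompl_def, zero_sub]

/-! ### Steps 2–4 and the factorized formula (eq. `factfinal`) -/

/-- **Step 4** (its display, without the boundary projectors): `det [[1, P_{Λ₀}Q⁻¹_{Ω*₀}Q_{Λ₁₂}],
[P_{Λ₂}Q⁻¹_{Ω*₁}Q_{Λ₁₀}, 1]] = det (1 − w)`. [cite: CeGiustiSchaefer2017, §2 Step 4 display] -/
theorem det_fromBlocks_one_one_eq :
    (fromBlocks 1 (B.omega₀⁻¹.toBlocks₁₂ * B.Q₁₂) (B.omega₁⁻¹.toBlocks₂₁ * B.Q₁₀) 1).det =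
      (1 - B.w).det := by
  rw [det_fromBlocks_one₂₂, w]
  simp only [Matrix.mul_assoc]

/-- **Step 4 with the boundary projectors**: for any `P₀`, `P₂` ("projectors on the inner boundary") with
`Q_{Λ₁₀} P₀ = Q_{Λ₁₀}` and `Q_{Λ₁₂} P₂ = Q_{Λ₁₂}`,
`det (1 − P₀ Q⁻¹_{Ω*₀} Q_{Λ₁₂} P₂ Q⁻¹_{Ω*₁} Q_{Λ₁₀} P₀) = det (1 − w)`: compressing `w` to the
boundary field does not change the determinant. [cite: CeGiustiSchaefer2017, §2 Step 4 display and the projector display after it] -/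
theorem det_one_sub_boundary_eq (P₀ : Matrix l₀ l₀ K) (P₂ : Matrix l₂ l₂ K)
    (hP₀ : B.Q₁₀ * P₀ = B.Q₁₀) (hP₂ : B.Q₁₂ * P₂ = B.Q₁₂) :
    (1 - P₀ * B.omega₀⁻¹.toBlocks₁₂ * B.Q₁₂ * P₂ * B.omega₁⁻¹.toBlocks₂₁ * B.Q₁₀ * P₀).det =
      (1 - B.w).det := by
  have e1 : P₀ * B.omega₀⁻¹.toBlocks₁₂ * B.Q₁₂ * P₂ * B.omega₁⁻¹.toBlocks₂₁ * B.Q₁₀ * P₀ =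
      (P₀ * B.omega₀⁻¹.toBlocks₁₂ * B.Q₁₂ * B.omega₁⁻¹.toBlocks₂₁) * B.Q₁₀ := by
    rw [Matrix.mul_assoc _ B.Q₁₀ P₀, hP₀, Matrix.mul_assoc _ B.Q₁₂ P₂, hP₂]
  have e2 : B.w = (B.omega₀⁻¹.toBlocks₁₂ * B.Q₁₂ * B.omega₁⁻¹.toBlocks₂₁) * B.Q₁₀ := rfl
  rw [e1, e2, det_one_sub_mul_comm, det_one_sub_mul_comm _ B.Q₁₀]
  congr 2
  simp only [Matrix.mul_assoc]
  rw [← Matrix.mul_assoc B.Q₁₀ P₀, hP₀]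

/-- **The factorization as a polynomial identity in the determinants**: `det Q = det Q_{Λ₁₁} ·
det schur₀ · det schur₂ · det (1 − w)` (Steps 1–4 combined: expand the Step-1 matrix around its `(2,2)`
entry and use `schur₀_mul_one_sub_w`). [cite: CeGiustiSchaefer2017, §2 Steps 1–4, eq. `factfinal`] -/
theorem det_full_eq (h₁ : IsUnit B.Q₁₁.det) (h₀ : IsUnit B.omega₀.det)
    (h₂ : IsUnit B.omega₁.det) :
    B.full.det = B.Q₁₁.det * B.schur₀.det * B.schur₂.det * (1 - B.w).det := by
  rw [B.det_full_step1 h₁,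
    det_fromBlocks_eq_det_schur_mul_det₂₂ _ _ _ _ (B.isUnit_det_schur₂ h₁ h₂)]
  have : B.schur₀ - -(B.Q₀₁ * B.Q₁₁⁻¹ * B.Q₁₂) * B.schur₂⁻¹ * -(B.Q₂₁ * B.Q₁₁⁻¹ * B.Q₁₀) =
      B.schur₀ * (1 - B.w) := by
    rw [B.schur₀_mul_one_sub_w h₁ h₀ h₂]
    simp only [Matrix.neg_mul, Matrix.mul_neg, neg_neg, Matrix.mul_assoc]
  rw [this, det_mul]
  ring

/-- **`det Q · det Q_{Λ₁₁} = det Q_{Ω*₀} · det Q_{Ω*₁} · det (1 − w)`** — eq. `factfinal` cleared of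
inverses (with eq. `detblock`: `1/(det Q⁻¹_{Λ₁₁} det[P_{Λ₀}Q⁻¹_{Ω*₀}P_{Λ₀}]) = det Q_{Ω*₀}` and
`1/det[P_{Λ₂}Q⁻¹_{Ω*₁}P_{Λ₂}] = det schur₂ = det Q_{Ω*₁}/det Q_{Λ₁₁}`).
[cite: CeGiustiSchaefer2017, §2 eq. `factfinal`] -/
theorem det_full_mul_det (h₁ : IsUnit B.Q₁₁.det) (h₀ : IsUnit B.omega₀.det)
    (h₂ : IsUnit B.omega₁.det) :
    B.full.det * B.Q₁₁.det = B.omega₀.det * B.omega₁.det * (1 - B.w).det := by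
  rw [B.det_full_eq h₁ h₀ h₂, B.det_omega₀ h₁, B.det_omega₁ h₁]
  ring

/-- **Eq. `factfinal`, multiplicative form**: `det Q · (det Q_{Λ₁₁}⁻¹ · det[P_{Λ₀} Q⁻¹_{Ω*₀} P_{Λ₀}] ·
det[P_{Λ₂} Q⁻¹_{Ω*₁} P_{Λ₂}]) = det (1 − w)`. [cite: CeGiustiSchaefer2017, §2 eq. `factfinal`] -/
theorem det_full_mul_inv_dets (h₁ : IsUnit B.Q₁₁.det) (h₀ : IsUnit B.omega₀.det)
    (h₂ : IsUnit B.omega₁.det) :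
    B.full.det * (B.Q₁₁⁻¹.det * (B.omega₀⁻¹.toBlocks₁₁).det * (B.omega₁⁻¹.toBlocks₂₂).det) =
      (1 - B.w).det := by
  rw [B.omega₀_inv_toBlocks₁₁ h₁ h₀, B.omega₁_inv_toBlocks₂₂ h₁ h₂, B.det_full_eq h₁ h₀ h₂]
  have e₁ := det_nonsing_inv_mul_det _ h₁
  have e₀ := det_nonsing_inv_mul_det _ (B.isUnit_det_schur₀ h₁ h₀)
  have e₂ := det_nonsing_inv_mul_det _ (B.isUnit_det_schur₂ h₁ h₂)
  calc B.Q₁₁.det * B.schur₀.det * B.schur₂.det * (1 - B.w).det *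
        (B.Q₁₁⁻¹.det * B.schur₀⁻¹.det * B.schur₂⁻¹.det)
      = (B.Q₁₁⁻¹.det * B.Q₁₁.det) * (B.schur₀⁻¹.det * B.schur₀.det) *
          (B.schur₂⁻¹.det * B.schur₂.det) * (1 - B.w).det := by ring
    _ = (1 - B.w).det := by rw [e₁, e₀, e₂, one_mul, one_mul, one_mul]

/-- **Eq. `factfinal` as printed**, over a field: `det Q = det (1 − w) / (det Q⁻¹_{Λ₁₁} ·
det[P_{Λ₀} Q⁻¹_{Ω*₀} P_{Λ₀}] · det[P_{Λ₂} Q⁻¹_{Ω*₁} P_{Λ₂}])`.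
[cite: CeGiustiSchaefer2017, §2 eq. `factfinal`] -/
theorem det_full_eq_div {K : Type*} [Field K] (B : Blocks K l₀ l₁ l₂) (h₁ : B.Q₁₁.det ≠ 0)
    (h₀ : B.omega₀.det ≠ 0) (h₂ : B.omega₁.det ≠ 0) :
    B.full.det = (1 - B.w).det /
      (B.Q₁₁⁻¹.det * (B.omega₀⁻¹.toBlocks₁₁).det * (B.omega₁⁻¹.toBlocks₂₂).det) := by
  have h₁' : IsUnit B.Q₁₁.det := isUnit_iff_ne_zero.mpr h₁
  have h₀' : IsUnit B.omega₀.det := isUnit_iff_ne_zero.mpr h₀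
  have h₂' : IsUnit B.omega₁.det := isUnit_iff_ne_zero.mpr h₂
  have hne : B.Q₁₁⁻¹.det * (B.omega₀⁻¹.toBlocks₁₁).det * (B.omega₁⁻¹.toBlocks₂₂).det ≠ 0 := by
    rw [B.omega₀_inv_toBlocks₁₁ h₁' h₀', B.omega₁_inv_toBlocks₂₂ h₁' h₂']
    refine mul_ne_zero (mul_ne_zero ?_ ?_) ?_ <;> refine isUnit_iff_ne_zero.mp ?_ <;>
      rw [isUnit_nonsing_inv_det_iff]
    exacts [h₁', B.isUnit_det_schur₀ h₁' h₀', B.isUnit_det_schur₂ h₁' h₂']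
  rw [eq_div_iff hne, B.det_full_mul_inv_dets h₁' h₀' h₂']

/-! ### Steps 2 and 3 as printed: the block `[P_{Λ₀} Q⁻¹ P_{Λ₀}]` -/

omit [Fintype l₀] [Fintype l₁] [Fintype l₂] [DecidableEq l₀] [DecidableEq l₁] [DecidableEq l₂] in
/-- `Q` re-associated as the two-block matrix `[[Q_{Λ₀₀}, (Q_{Λ₀₁}, 0)], [(Q_{Λ₁₀}; 0), Q_{Ω*₁}]]`
(`Γ = Λ₀`, `Γ* = Λ₁ ∪ Λ₂`). [cite: CeGiustiSchaefer2017, §2 Step 2] -/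
theorem full_submatrix_sumAssoc :
    B.full.submatrix (Equiv.sumAssoc l₀ l₁ l₂).symm (Equiv.sumAssoc l₀ l₁ l₂).symm =
      fromBlocks B.Q₀₀ (fromCols B.Q₀₁ (0 : Matrix l₀ l₂ K)) (fromRows B.Q₁₀ (0 : Matrix l₂ l₀ K))
        B.omega₁ := by
  ext (i | (i | i)) (j | (j | j)) <;> rfl

/-- The Schur complement of `Q_{Ω*₁}` (the `Λ₁ ∪ Λ₂` block) in `Q` is `schur₀ · (1 − w)`:
`Q_{Λ₀₀} − Q_{Λ₀₁} (Q_{Ω*₁}⁻¹)_{Λ₁Λ₁} Q_{Λ₁₀} = schur₀ (1 − w)`.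
[cite: CeGiustiSchaefer2017, §2 Steps 2–4] -/
theorem schurCompl_omega₁_eq (h₁ : IsUnit B.Q₁₁.det) (h₀ : IsUnit B.omega₀.det)
    (h₂ : IsUnit B.omega₁.det) :
    B.Q₀₀ - fromCols B.Q₀₁ (0 : Matrix l₀ l₂ K) * B.omega₁⁻¹ * fromRows B.Q₁₀ (0 : Matrix l₂ l₀ K) =
      B.schur₀ * (1 - B.w) := by
  rw [B.schur₀_mul_one_sub_w h₁ h₀ h₂, B.omega₁_inv h₁ h₂, fromCols_mul_fromBlocks,
    fromCols_mul_fromRows, schur₀]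
  simp only [Matrix.zero_mul, Matrix.mul_zero, add_zero, Matrix.mul_add, Matrix.add_mul,
    Matrix.mul_assoc, sub_sub]

/-- `schur₀ (1 − w)` — the Schur complement of `Q_{Ω*₁}` in `Q` — is nonsingular when `Q`,
`Q_{Λ₁₁}`, `Q_{Ω*₀}`, `Q_{Ω*₁}` are (from `det_full_eq`). [cite: CeGiustiSchaefer2017, §2 eq. `factfinal`] -/
theorem isUnit_det_schur₀_mul_one_sub_w (h₁ : IsUnit B.Q₁₁.det) (h₀ : IsUnit B.omega₀.det)
    (h₂ : IsUnit B.omega₁.det) (hQ : IsUnit B.full.det) : IsUnit (B.schur₀ * (1 - B.w)).det := by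
  rw [det_mul]
  refine IsUnit.mul (B.isUnit_det_schur₀ h₁ h₀) ?_
  rw [B.det_full_eq h₁ h₀ h₂] at hQ
  exact (IsUnit.mul_iff.mp hQ).2

/-- The App. A block inverse of `Q` around `Q_{Ω*₁}` (the `Λ₁ ∪ Λ₂` block), `Q` re-associated as in
`full_submatrix_sumAssoc`; its leading block is `[P_{Λ₀} Q⁻¹ P_{Λ₀}] = (schur₀ (1 − w))⁻¹`.
[cite: CeGiustiSchaefer2017, §2 Steps 2–3 with the App. A block-inverse display] -/
theorem inv_full_submatrix_sumAssoc (h₁ : IsUnit B.Q₁₁.det) (h₀ : IsUnit B.omega₀.det)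
    (h₂ : IsUnit B.omega₁.det) (hQ : IsUnit B.full.det) :
    (B.full.submatrix (Equiv.sumAssoc l₀ l₁ l₂).symm (Equiv.sumAssoc l₀ l₁ l₂).symm)⁻¹ =
      fromBlocks (B.schur₀ * (1 - B.w))⁻¹
        (-((B.schur₀ * (1 - B.w))⁻¹ * fromCols B.Q₀₁ (0 : Matrix l₀ l₂ K) * B.omega₁⁻¹))
        (-(B.omega₁⁻¹ * fromRows B.Q₁₀ (0 : Matrix l₂ l₀ K) * (B.schur₀ * (1 - B.w))⁻¹))
        (B.omega₁⁻¹ + B.omega₁⁻¹ * fromRows B.Q₁₀ (0 : Matrix l₂ l₀ K) *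
          (B.schur₀ * (1 - B.w))⁻¹ * fromCols B.Q₀₁ (0 : Matrix l₀ l₂ K) * B.omega₁⁻¹) := by
  have hS := B.isUnit_det_schur₀_mul_one_sub_w h₁ h₀ h₂ hQ
  rw [full_submatrix_sumAssoc, inv_fromBlocks_of_isUnit_det₂₂ _ _ _ _ h₂
    (by rw [B.schurCompl_omega₁_eq h₁ h₀ h₂]; exact hS), B.schurCompl_omega₁_eq h₁ h₀ h₂]

/-- **`[P_{Λ₀} Q⁻¹ P_{Λ₀}] = (schur₀ (1 − w))⁻¹`**: the `Λ₀Λ₀` block of the full propagator is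
the inverse of the Schur complement of `Q_{Ω*₁}` in `Q`. [cite: CeGiustiSchaefer2017, §2 Steps 2–3
with the App. A block-inverse display] -/
theorem inv_full_toBlocks₀₀ (h₁ : IsUnit B.Q₁₁.det) (h₀ : IsUnit B.omega₀.det)
    (h₂ : IsUnit B.omega₁.det) (hQ : IsUnit B.full.det) :
    B.full⁻¹.toBlocks₁₁.toBlocks₁₁ = (B.schur₀ * (1 - B.w))⁻¹ := by
  have key := B.inv_full_submatrix_sumAssoc h₁ h₀ h₂ hQ
  rw [inv_submatrix_equiv] at key
  ext i j
  have := congr_fun (congr_fun key (Sum.inl i)) (Sum.inl j)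
  simpa [toBlocks₁₁] using this

/-- **The factorised long-distance propagator, exactly** (the 2016 paper's §4 Step 2 in the
three-block setting, before any approximation): for sink in `Λ₂` and source in `Λ₀`,
`(Q⁻¹)_{Λ₂Λ₀} = −(Q_{Ω*₁}⁻¹)_{Λ₂Λ₁} Q_{Λ₁₀} [P_{Λ₀} Q⁻¹ P_{Λ₀}]`
`= −(Q_{Ω*₁}⁻¹)_{Λ₂Λ₁} Q_{Λ₁₀} (schur₀ (1 − w))⁻¹` — one two-block propagator, the boundary
hop `Q_{Λ₁₀}`, and the `Λ₀Λ₀` propagator. [cite: CeGiustiSchaefer2016, §4 Step 2 eq. `stp2`]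
[cite: CeGiustiSchaefer2017, §2 (definition of w)] -/
theorem inv_full_apply₂₀ (h₁ : IsUnit B.Q₁₁.det) (h₀ : IsUnit B.omega₀.det)
    (h₂ : IsUnit B.omega₁.det) (hQ : IsUnit B.full.det) (i : l₂) (j : l₀) :
    B.full⁻¹ (Sum.inr i) (Sum.inl (Sum.inl j)) =
      (-(B.omega₁⁻¹.toBlocks₂₁ * B.Q₁₀ * (B.schur₀ * (1 - B.w))⁻¹)) i j := by
  have key := B.inv_full_submatrix_sumAssoc h₁ h₀ h₂ hQ
  rw [inv_submatrix_equiv] at key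
  have := congr_fun (congr_fun key (Sum.inr (Sum.inr i))) (Sum.inl j)
  simp only [submatrix_apply, Equiv.sumAssoc_symm_apply_inr_inr, Equiv.sumAssoc_symm_apply_inl,
    fromBlocks_apply₂₁] at this
  rw [this]
  have hm : B.omega₁⁻¹ * fromRows B.Q₁₀ (0 : Matrix l₂ l₀ K) =
      fromRows (B.omega₁⁻¹.toBlocks₁₁ * B.Q₁₀) (B.omega₁⁻¹.toBlocks₂₁ * B.Q₁₀) := by
    conv_lhs => rw [← fromBlocks_toBlocks B.omega₁⁻¹]
    rw [fromBlocks_mul_fromRows]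
    simp only [Matrix.mul_zero, add_zero]
  rw [hm, fromRows_mul, Matrix.neg_apply, fromRows_apply_inr, Matrix.neg_apply]

/-- **Step 2, eq. `step2`** (multiplicative form): `det Q · det Q⁻¹_{Λ₁₁} · det[P_{Λ₂} Q⁻¹_{Ω*₁}
P_{Λ₂}] · det[P_{Λ₀} Q⁻¹ P_{Λ₀}] = 1`. [cite: CeGiustiSchaefer2017, §2 Step 2 eq. `step2`] -/
theorem det_full_mul_step2 (h₁ : IsUnit B.Q₁₁.det) (h₀ : IsUnit B.omega₀.det)
    (h₂ : IsUnit B.omega₁.det) (hQ : IsUnit B.full.det) :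
    B.full.det * (B.Q₁₁⁻¹.det * (B.omega₁⁻¹.toBlocks₂₂).det *
      (B.full⁻¹.toBlocks₁₁.toBlocks₁₁).det) = 1 := by
  have hS := B.isUnit_det_schur₀_mul_one_sub_w h₁ h₀ h₂ hQ
  rw [B.inv_full_toBlocks₀₀ h₁ h₀ h₂ hQ, B.omega₁_inv_toBlocks₂₂ h₁ h₂, B.det_full_eq h₁ h₀ h₂]
  have e₁ := det_nonsing_inv_mul_det _ h₁
  have e₂ := det_nonsing_inv_mul_det _ (B.isUnit_det_schur₂ h₁ h₂)
  have eS := det_nonsing_inv_mul_det _ hS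
  rw [det_mul] at eS
  calc B.Q₁₁.det * B.schur₀.det * B.schur₂.det * (1 - B.w).det *
        (B.Q₁₁⁻¹.det * B.schur₂⁻¹.det * (B.schur₀ * (1 - B.w))⁻¹.det)
      = (B.Q₁₁⁻¹.det * B.Q₁₁.det) * (B.schur₂⁻¹.det * B.schur₂.det) *
          ((B.schur₀ * (1 - B.w))⁻¹.det * (B.schur₀.det * (1 - B.w).det)) := by ring
    _ = 1 := by rw [e₁, e₂, eS, one_mul, one_mul]

/-- **Step 3, eq. `step3`** (multiplicative form): `det[P_{Λ₀} Q⁻¹_{Ω*₀} P_{Λ₀}] =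
det[P_{Λ₀} Q⁻¹ P_{Λ₀}] · det [[1, P_{Λ₀}Q⁻¹_{Ω*₀}Q_{Λ₁₂}], [P_{Λ₂}Q⁻¹_{Ω*₁}Q_{Λ₁₀}, 1]]`.
[cite: CeGiustiSchaefer2017, §2 Step 3 eq. `step3`] -/
theorem det_step3 (h₁ : IsUnit B.Q₁₁.det) (h₀ : IsUnit B.omega₀.det)
    (h₂ : IsUnit B.omega₁.det) (hQ : IsUnit B.full.det) :
    (B.omega₀⁻¹.toBlocks₁₁).det =
      (B.full⁻¹.toBlocks₁₁.toBlocks₁₁).det *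
        (fromBlocks 1 (B.omega₀⁻¹.toBlocks₁₂ * B.Q₁₂) (B.omega₁⁻¹.toBlocks₂₁ * B.Q₁₀) 1).det := by
  have hw : IsUnit (1 - B.w).det := by
    have := hQ; rw [B.det_full_eq h₁ h₀ h₂] at this
    exact (IsUnit.mul_iff.mp this).2
  rw [B.det_fromBlocks_one_one_eq, B.inv_full_toBlocks₀₀ h₁ h₀ h₂ hQ,
    B.omega₀_inv_toBlocks₁₁ h₁ h₀, Matrix.mul_inv_rev, det_mul]
  calc B.schur₀⁻¹.det = B.schur₀⁻¹.det * ((1 - B.w)⁻¹.det * (1 - B.w).det) := by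
        rw [det_nonsing_inv_mul_det _ hw, mul_one]
    _ = (1 - B.w)⁻¹.det * B.schur₀⁻¹.det * (1 - B.w).det := by ring

/-! ### §2.1: `w` through the full propagator -/

omit [Fintype l₂] [DecidableEq l₂] in
/-- The `Λ₂Λ₂`-sandwich appearing in §2.1: `(0, Q_{Λ₂₁}) Q_{Ω*₀}⁻¹ (0; Q_{Λ₁₂}) =
Q_{Λ₂₁} (Q_{Ω*₀}⁻¹)_{Λ₁Λ₁} Q_{Λ₁₂}`. [cite: CeGiustiSchaefer2017, §2.1 first display] -/
theorem fromCols_mul_omega₀_inv_mul_fromRows :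
    fromCols (0 : Matrix l₂ l₀ K) B.Q₂₁ * B.omega₀⁻¹ * fromRows (0 : Matrix l₀ l₂ K) B.Q₁₂ =
      B.Q₂₁ * B.omega₀⁻¹.toBlocks₂₂ * B.Q₁₂ := by
  conv_lhs => rw [← fromBlocks_toBlocks B.omega₀⁻¹]
  rw [fromCols_mul_fromBlocks, fromCols_mul_fromRows]
  simp only [Matrix.zero_mul, zero_add, Matrix.mul_zero]

/-- **§2.1, `w` in terms of the full propagator** (the `Λ₀ ∪ Λ₁` rows; the printed identity is its
restriction to the `∂Λ₀` rows): "By considering two different partitions of the lattice in two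
blocks … it is easy to show that `P_{∂Λ₀} Q⁻¹_{Ω*₀} Q_{Λ₁₂} = P_{∂Λ₀} Q⁻¹ {Q_{Λ₁₂} + Q_{Λ₂₁}
Q⁻¹_{Ω*₀} Q_{Λ₁₂}}`" — here `Q_{Ω*₀}⁻¹ (0; Q_{Λ₁₂}) = (Q⁻¹)_{Ω*₀Ω*₀} (0; Q_{Λ₁₂}) +
(Q⁻¹)_{Ω*₀Λ₂} · Q_{Λ₂₁} (Q_{Ω*₀}⁻¹)_{Λ₁Λ₁} Q_{Λ₁₂}` for invertible `Q` and `Q_{Ω*₀}` ("two propagators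
between the boundaries of the block `Λ₀` and `Λ₂`, each one multiplied by an effective boundary
operator, appear in the definition of `w`"); the second line is `omega₁_inv_mul_eq_propagator`.
[cite: CeGiustiSchaefer2017, §2.1 first display] -/
theorem omega₀_inv_mul_eq_propagator (h₀ : IsUnit B.omega₀.det) (hQ : IsUnit B.full.det) :
    B.omega₀⁻¹ * fromRows (0 : Matrix l₀ l₂ K) B.Q₁₂ =
      B.full⁻¹.toBlocks₁₁ * fromRows (0 : Matrix l₀ l₂ K) B.Q₁₂ +
        B.full⁻¹.toBlocks₁₂ * (B.Q₂₁ * B.omega₀⁻¹.toBlocks₂₂ * B.Q₁₂) := by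
  have hXQ : B.full⁻¹ * B.full = 1 := nonsing_inv_mul _ hQ
  rw [← fromBlocks_toBlocks B.full⁻¹] at hXQ
  conv_lhs at hXQ => rw [full, fromBlocks_multiply]
  rw [← fromBlocks_one, fromBlocks_inj] at hXQ
  obtain ⟨h11, -, -, -⟩ := hXQ
  -- `X₁₁ Q_{Ω*₀} + X₁₂ (0, Q_{Λ₂₁}) = 1`; multiply on the right by `Q_{Ω*₀}⁻¹ (0; Q_{Λ₁₂})`.
  have key := congrArg (fun M => M * (B.omega₀⁻¹ * fromRows (0 : Matrix l₀ l₂ K) B.Q₁₂)) h11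
  simp only [Matrix.one_mul, Matrix.add_mul] at key
  rw [← key, ← B.fromCols_mul_omega₀_inv_mul_fromRows]
  simp only [Matrix.mul_assoc]
  rw [← Matrix.mul_assoc B.omega₀ B.omega₀⁻¹, mul_nonsing_inv _ h₀, Matrix.one_mul]
  rfl

omit [Fintype l₀] [DecidableEq l₀] in
/-- The `Λ₀Λ₀`-sandwich of the mirror identity: `(Q_{Λ₀₁}, 0) Q_{Ω*₁}⁻¹ (Q_{Λ₁₀}; 0) =
Q_{Λ₀₁} (Q_{Ω*₁}⁻¹)_{Λ₁Λ₁} Q_{Λ₁₀}`. [cite: CeGiustiSchaefer2017, §2.1 first display (second line)] -/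
theorem fromCols_mul_omega₁_inv_mul_fromRows :
    fromCols B.Q₀₁ (0 : Matrix l₀ l₂ K) * B.omega₁⁻¹ * fromRows B.Q₁₀ (0 : Matrix l₂ l₀ K) =
      B.Q₀₁ * B.omega₁⁻¹.toBlocks₁₁ * B.Q₁₀ := by
  conv_lhs => rw [← fromBlocks_toBlocks B.omega₁⁻¹]
  rw [fromCols_mul_fromBlocks, fromCols_mul_fromRows]
  simp only [Matrix.zero_mul, add_zero, Matrix.mul_zero]

/-- **§2.1, second line** (the `Λ₁ ∪ Λ₂` rows; the printed identity is its restriction to the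
`∂Λ₂` rows): "`P_{∂Λ₂} Q⁻¹_{Ω*₁} Q_{Λ₁₀} = P_{∂Λ₂} Q⁻¹ {Q_{Λ₁₀} + Q_{Λ₀₁} Q⁻¹_{Ω*₁} Q_{Λ₁₀}}`" —
with `X = Q⁻¹` re-associated as in `full_submatrix_sumAssoc` (`Λ₀` first, then `Ω*₁ = Λ₁ ∪ Λ₂`):
`Q_{Ω*₁}⁻¹ (Q_{Λ₁₀}; 0) = X_{Ω*₁Ω*₁} (Q_{Λ₁₀}; 0) + X_{Ω*₁Λ₀} · Q_{Λ₀₁} (Q_{Ω*₁}⁻¹)_{Λ₁Λ₁} Q_{Λ₁₀}`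
for invertible `Q` and `Q_{Ω*₁}`. [cite: CeGiustiSchaefer2017, §2.1 first display (second line)] -/
theorem omega₁_inv_mul_eq_propagator (h₂ : IsUnit B.omega₁.det) (hQ : IsUnit B.full.det) :
    B.omega₁⁻¹ * fromRows B.Q₁₀ (0 : Matrix l₂ l₀ K) =
      (B.full⁻¹.submatrix (Equiv.sumAssoc l₀ l₁ l₂).symm (Equiv.sumAssoc l₀ l₁ l₂).symm).toBlocks₂₂ *
          fromRows B.Q₁₀ (0 : Matrix l₂ l₀ K) +
        (B.full⁻¹.submatrix (Equiv.sumAssoc l₀ l₁ l₂).symm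
            (Equiv.sumAssoc l₀ l₁ l₂).symm).toBlocks₂₁ *
          (B.Q₀₁ * B.omega₁⁻¹.toBlocks₁₁ * B.Q₁₀) := by
  set X := B.full⁻¹.submatrix (Equiv.sumAssoc l₀ l₁ l₂).symm (Equiv.sumAssoc l₀ l₁ l₂).symm
    with hX
  have hQ' : IsUnit (B.full.submatrix (Equiv.sumAssoc l₀ l₁ l₂).symm
      (Equiv.sumAssoc l₀ l₁ l₂).symm).det := by rwa [det_submatrix_equiv_self]
  have hXQ : X * B.full.submatrix (Equiv.sumAssoc l₀ l₁ l₂).symm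
      (Equiv.sumAssoc l₀ l₁ l₂).symm = 1 := by
    rw [hX, ← inv_submatrix_equiv]
    exact nonsing_inv_mul _ hQ'
  rw [← fromBlocks_toBlocks X, full_submatrix_sumAssoc, fromBlocks_multiply, ← fromBlocks_one,
    fromBlocks_inj] at hXQ
  obtain ⟨-, -, -, h22⟩ := hXQ
  -- `X₂₁ (Q_{Λ₀₁}, 0) + X₂₂ Q_{Ω*₁} = 1`; multiply on the right by `Q_{Ω*₁}⁻¹ (Q_{Λ₁₀}; 0)`.
  have key := congrArg (fun M => M * (B.omega₁⁻¹ * fromRows B.Q₁₀ (0 : Matrix l₂ l₀ K))) h22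
  simp only [Matrix.one_mul, Matrix.add_mul] at key
  rw [← key, ← B.fromCols_mul_omega₁_inv_mul_fromRows, add_comm]
  simp only [Matrix.mul_assoc]
  rw [← Matrix.mul_assoc B.omega₁ B.omega₁⁻¹, mul_nonsing_inv _ h₂, Matrix.one_mul]

/-! ### `det (1 − w)` is real for Hermitian `Q` -/

omit [Fintype l₀] [Fintype l₁] [Fintype l₂] [DecidableEq l₀] [DecidableEq l₁] [DecidableEq l₂] in
/-- The blocks of a Hermitian `Q`: `Q_{Ω*₀}`, `Q_{Ω*₁}` and `Q_{Λ₁₁}` are Hermitian (principal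
submatrices). [cite: CeGiustiSchaefer2017, App. `app:Dw` ("the operator Q = γ₅D, which is Hermitian")] -/
theorem isHermitian_blocks {K : Type*} [CommRing K] [StarRing K] (B : Blocks K l₀ l₁ l₂)
    (hH : B.full.IsHermitian) :
    B.omega₀.IsHermitian ∧ B.omega₁.IsHermitian ∧ B.Q₁₁.IsHermitian := by
  have h0 : B.omega₀.IsHermitian := by
    have := hH.submatrix (Sum.inl : l₀ ⊕ l₁ → (l₀ ⊕ l₁) ⊕ l₂)
    convert this using 1
    ext i j; rfl
  refine ⟨h0, ?_, ?_⟩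
  · have := (hH.submatrix (Equiv.sumAssoc l₀ l₁ l₂).symm).submatrix
      (Sum.inr : l₁ ⊕ l₂ → l₀ ⊕ (l₁ ⊕ l₂))
    rw [full_submatrix_sumAssoc] at this
    convert this using 1
    ext i j; rfl
  · have := h0.submatrix (Sum.inr : l₁ → l₀ ⊕ l₁)
    convert this using 1
    ext i j; rfl

/-- "Note that `det (1 − w)` is real since all other determinants entering Eq. (factfinal) are
real": for a Hermitian `Q` over `ℂ` with `Q_{Λ₁₁}`, `Q_{Ω*₀}`, `Q_{Ω*₁}` nonsingular,
`det (1 − w) = det Q · det Q_{Λ₁₁} / (det Q_{Ω*₀} · det Q_{Ω*₁})` is a quotient of real numbers.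
[cite: CeGiustiSchaefer2017, §2 (sentence after eq. `factfinal`)] -/
theorem star_det_one_sub_w (B : Blocks ℂ l₀ l₁ l₂) (hH : B.full.IsHermitian) (h₁ : B.Q₁₁.det ≠ 0)
    (h₀ : B.omega₀.det ≠ 0) (h₂ : B.omega₁.det ≠ 0) :
    star (1 - B.w).det = (1 - B.w).det := by
  obtain ⟨hΩ₀, hΩ₁, hQ₁₁⟩ := B.isHermitian_blocks hH
  have key := B.det_full_mul_det (isUnit_iff_ne_zero.mpr h₁) (isUnit_iff_ne_zero.mpr h₀)
    (isUnit_iff_ne_zero.mpr h₂)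
  have hw : (1 - B.w).det = B.full.det * B.Q₁₁.det / (B.omega₀.det * B.omega₁.det) := by
    rw [eq_div_iff (mul_ne_zero h₀ h₂), key]; ring
  rw [hw, star_div₀, star_mul, star_mul, ← det_conjTranspose, ← det_conjTranspose,
    ← det_conjTranspose, ← det_conjTranspose, hH.eq, hQ₁₁.eq, hΩ₀.eq, hΩ₁.eq]
  ring

/-! ### The complementary elimination order: interiors first, separator last
(Giusti–Saccardi 2022 eq. `detD`; the nested-dissection step) and the reduced determinant
(Giusti–Saccardi 2022 App. A eq. `reduced`) -/

omit [Fintype l₁] [DecidableEq l₁] in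
/-- The inverse of the block-diagonal matrix `diag(Q_{Λ₀₀}, Q_{Λ₂₂})` (the two interiors do not
talk to each other). [cite: GiustiSaccardi2022, §3 eq. `detD` (block-diagonal `D_{Λ̄₀ ∪ Λ₁}`)] -/
theorem inv_fromBlocks_diag (h₀₀ : IsUnit B.Q₀₀.det) (h₂₂ : IsUnit B.Q₂₂.det) :
    (fromBlocks B.Q₀₀ 0 0 B.Q₂₂)⁻¹ = fromBlocks B.Q₀₀⁻¹ 0 0 B.Q₂₂⁻¹ := by
  refine Matrix.inv_eq_left_inv ?_
  rw [fromBlocks_multiply]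
  simp only [Matrix.mul_zero, Matrix.zero_mul, add_zero, zero_add, nonsing_inv_mul _ h₀₀,
    nonsing_inv_mul _ h₂₂, fromBlocks_one]

/-- **Interiors first** (Giusti–Saccardi, eq. `detD`: "`det D = det D_{Λ̄₀} det D_{Λ₁} det D̃_{∂Λ₀}`"
with `D̃_{∂Λ₀} = D̄_{∂Λ₀} − D_{∂Λ₀,Λ₁} D_{Λ₁}⁻¹ D_{Λ₁,∂Λ₀}`, `D̄_{∂Λ₀} = D_{∂Λ₀} − D_{∂Λ₀,Λ̄₀}
D_{Λ̄₀}⁻¹ D_{Λ̄₀,∂Λ₀}`): in the three-block matrix read `Λ₁` as the separator `∂Λ₀` and `Λ₀`,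
`Λ₂` as the two regions it separates; eliminating both interiors gives
`det Q = det Q_{Λ₀₀} · det Q_{Λ₂₂} · det (Q_{Λ₁₁} − Q_{Λ₁₀}Q_{Λ₀₀}⁻¹Q_{Λ₀₁} − Q_{Λ₁₂}Q_{Λ₂₂}⁻¹Q_{Λ₂₁})`.
[cite: GiustiSaccardi2022, §3 eq. `detD` and the two displays after it]
[cite: CeGiustiSchaefer2017, App. A eq. `detblock`] -/
theorem det_full_separator (h₀₀ : IsUnit B.Q₀₀.det) (h₂₂ : IsUnit B.Q₂₂.det) :
    B.full.det = B.Q₀₀.det * B.Q₂₂.det *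
      (B.Q₁₁ - B.Q₁₀ * B.Q₀₀⁻¹ * B.Q₀₁ - B.Q₁₂ * B.Q₂₂⁻¹ * B.Q₂₁).det := by
  have hD : IsUnit (fromBlocks B.Q₀₀ 0 0 B.Q₂₂).det := by
    rw [det_fromBlocks_zero₂₁]; exact h₀₀.mul h₂₂
  rw [← det_submatrix_equiv_self (reindex₁ l₀ l₁ l₂).symm B.full, full_submatrix_reindex₁,
    det_fromBlocks_eq_det_schur_mul_det₂₂ _ _ _ _ hD, B.inv_fromBlocks_diag h₀₀ h₂₂,
    fromCols_mul_fromBlocks, fromCols_mul_fromRows, det_fromBlocks_zero₂₁]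
  simp only [Matrix.mul_zero, add_zero, zero_add, sub_sub]
  ring

end Blocks

/-- **The reduced determinant** (Giusti–Saccardi, App. A eq. `reduced`): "If `B` and `C` act only on
subspaces identified by the projectors `𝒫₁` and `𝒫₂` … `det [[A, B], [C, D]] = det A det D
det [[𝟙, 𝒜⁻¹ℬ], [𝒟⁻¹𝒞, 𝟙]]` where `𝒜⁻¹ = 𝒫₁A⁻¹𝒫₁`, `ℬ = 𝒫₁B𝒫₂`, `𝒞 = 𝒫₂C𝒫₁`, `𝒟⁻¹ = 𝒫₂D⁻¹𝒫₂`.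
Notice that the dimensionality of the last matrix … is smaller".  Lean reading: the supports are
index types `s₁`, `s₂` with extension/restriction matrices `E₁ : m × s₁`, `R₁ : s₁ × m`,
`E₂ : n × s₂`, `R₂ : s₂ × n` and `B = E₁ B₁ R₂`, `C = E₂ C₁ R₁`; then `𝒜⁻¹ = R₁ A⁻¹ E₁`,
`𝒟⁻¹ = R₂ D⁻¹ E₂` and the last determinant is over `s₁ ⊕ s₂`.
[cite: GiustiSaccardi2022, App. A eq. `reduced`] -/
theorem det_fromBlocks_eq_det_mul_det_mul_det_reduced {m n s₁ s₂ : Type*} [Fintype m] [Fintype n]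
    [Fintype s₁] [Fintype s₂] [DecidableEq m] [DecidableEq n] [DecidableEq s₁] [DecidableEq s₂]
    (A : Matrix m m K) (D : Matrix n n K) (E₁ : Matrix m s₁ K) (R₁ : Matrix s₁ m K)
    (E₂ : Matrix n s₂ K) (R₂ : Matrix s₂ n K) (B₁ : Matrix s₁ s₂ K) (C₁ : Matrix s₂ s₁ K)
    (hA : IsUnit A.det) (hD : IsUnit D.det) :
    (fromBlocks A (E₁ * B₁ * R₂) (E₂ * C₁ * R₁) D).det =
      A.det * D.det * (fromBlocks 1 (R₁ * A⁻¹ * E₁ * B₁) (R₂ * D⁻¹ * E₂ * C₁) 1).det := by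
  letI := Matrix.invertibleOfIsUnitDet A hA
  rw [det_fromBlocks₁₁, invOf_eq_nonsing_inv, det_fromBlocks_one₁₁]
  have hfac : D - E₂ * C₁ * R₁ * A⁻¹ * (E₁ * B₁ * R₂) =
      D * (1 - D⁻¹ * E₂ * C₁ * R₁ * A⁻¹ * E₁ * B₁ * R₂) := by
    rw [Matrix.mul_sub, Matrix.mul_one]
    simp only [← Matrix.mul_assoc]
    rw [mul_nonsing_inv _ hD, Matrix.one_mul]
  rw [hfac, det_mul, mul_assoc]
  congr 2
  rw [show D⁻¹ * E₂ * C₁ * R₁ * A⁻¹ * E₁ * B₁ * R₂ = (D⁻¹ * E₂ * C₁ * R₁ * A⁻¹ * E₁ * B₁) * R₂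
      from rfl, det_one_sub_mul_comm]
  congr 2
  simp only [Matrix.mul_assoc]

end DeterminantDomainFactorization

end Literature.Analysis.Matrix
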